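import Literature.AlgebraicGeometry.Frobenioids.ArithmeticFrobenioidThm64ivCompat
import Literature.AlgebraicGeometry.Frobenioids.MotivatingExamplesSubSplitPrimes
import HarnessLib

/-!
# Frobenioids I, Theorem 6.4 (iv), second clause for `F₁` NOT Galois over `ℚ` — what the Cor. 4.11 (iv) datum
# DOES give (arithmetic equivalence of the base fields) and the weakest printed-faithful residual hypothesis
# (GAP-LEDGER G-L1t3-1 #2; row T64iv/L07b of `plan/L1/SUBDAG-FrdI-Thm64.md` at the data)

Mochizuki, *The geometry of Frobenioids I: the general theory*, Kyushu J. Math. **62** (2008) 293–400, §6,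
Thm. 6.4 (iv) p. 115 l. 23–29 («… is isomorphic to `L₁` in a fashion that is compatible with an isomorphism
`F₁ ⥲ F₂`») and its proof p. 116 l. 17–35, which ends at «`L₁ ⊆ L₂`, hence `L₁ = L₂` [since `[L₁ : ℚ] = [L₂ : ℚ]`]»
and does not argue the compatibility with an isomorphism `F₁ ⥲ F₂` [cite: MochizukiFrdI2008, Thm. 6.4 (iv) p.115].

PROOF-ONLY file (cell abc-iut, layer L1; seat abc-iut-w4-d090 gen 5; 0 definitions, no named facts, no new
`Prop`). State of the row before this file (seats abc-iut-L1-d4 / abc-iut-L1-d7, `ArithmeticFrobenioidThm64ivCompat`,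
`MotivatingExamplesThm64ivBaseCompat`, `…NormPreservation`): AT THE CONSTRUCTIONS (`Ψ : C_{K₁/F₁} ⥲ C_{K₂/F₂}` an
equivalence of THE arithmetic Frobenioids with its Cor. 4.11 (iv) datum `(Ψ^Base, Ψ^Φ = E, η, hdiv)`) the printed
clause at `X = Spec L₁`, `L₁` Galois over `ℚ`, holds IFF `F₁ ≅ F₂` (`Thm64iv_arith_compat_iff`), and `F₁ ≅ F₂` is
PROVED when `F₁` is Galois over `ℚ`. This file records, for ARBITRARY `F₁`:

* `arith_exists_base_placeEquiv` — what the datum gives at the base UNCONDITIONALLY: writing `B₁ = "Spec F₁"`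
  (`ε₁ : B₁.L ≃ₐ[F₁] F₁`) and `B₂ := Ψ^Base B₁` (`≃ₐ[F₂] F₂`, terminal objects correspond), a bijection
  `π₀ : FinitePlace B₁.L ≃ FinitePlace B₂.L` preserving residue characteristics AND absolute norms
  (abc-iut-L1-d7's `arith_residueChar_transport` / `arith_logNorm_transport`, i.e. Thm. 6.4 (iii) for `Ψ` with
  `deg(Ψ^rlf) = 1`) — that is, **`F₁` and `F₂` are arithmetically equivalent** in the place-bijection form (same
  number of places of each norm), whence `[F₁ : ℚ] = [F₂ : ℚ]`, the same numbers of places over every `p` and the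
  same completely split primes (`arith_base_degreeEq`, through abc-iut-w4-d109's `Thm64iv_L04_degreeEq_holds`);
* `Thm64iv_arith_compat_of_solitary` — the printed clause at every `X` Galois over `ℚ` from the WEAKEST
  printed-faithful residual hypothesis, carried as an explicit theorem binder (a conditional result, no `Prop`
  definition): «`F₁` is arithmetically solitary along the datum» =
  `∀ π₀ : FinitePlace B₁.L ≃ FinitePlace B₂.L`, residue-characteristic- and norm-preserving `→ Nonempty (B₁.L ≃+* B₂.L)`;
  it is DISCHARGED here for `F₁` Galois over `ℚ` (`arith_solitary_of_isGalois_base`; fed to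
  `Thm64iv_arith_compat_of_solitary` it recovers abc-iut-L1-d4's `Thm64iv_arith_compat_of_isGalois_base`) and is implied by — strictly weaker than positing —
  `F₁ ≅ F₂` (`arith_solitary_of_baseIso`); conversely the clause at any one `X` forces `Nonempty (B₁.L ≃+* B₂.L)`
  (`nonempty_base_ringEquiv_of_compat`), so nothing weaker of this shape can close the row.

REMARK OF RECORD (typed nowhere, proved nowhere — the honest status of the residual). (1) With `F̃_i` an ALGEBRAIC
CLOSURE (print's general setting) `Ψ^Base : B(G_{F₁})⁰ ⥲ B(G_{F₂})⁰` yields an isomorphism of profinite groups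
`G_{F₁} ≅ G_{F₂}`, and «`G_{F₁} ≅ G_{F₂} ⇒ F₁ ≅ F₂`» is the Neukirch–Uchida theorem (Neukirch 1969, Uchida 1976) —
not in Mathlib, not on the cell's FACT-LIST, so not available to this file. (2) In the TYPED setting `F̃_i = K_i` is a
FINITE Galois extension; then no anabelian input exists and the natural test case is a Gassmann triple
`(G, H₁, H₂)` with `H₂ = σ(H₁)` for an OUTER automorphism `σ` of `G = Gal(K/ℚ)` — e.g. `G = PSL₂(𝔽₇)`, `H = S₄`
(Perlis' degree-7 arithmetically equivalent, non-isomorphic fields `F_i = K^{H_i}`): there the conclusion of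
`arith_exists_base_placeEquiv` holds with `F₁ ≇ F₂`, so the solitary binder is exactly what separates the data from
the printed clause; whether THE Frobenioids `C_{K/F₁}`, `C_{K/F₂}` are actually equivalent in such a case (which would
refute the clause as typed) depends on the multiplicative data `(K'^×, div)` as `σ`-twisted Galois modules up the
tower and is left open. (3) By Perlis (1977) number fields of degree `≤ 6` are arithmetically solitary, so the binder
also holds whenever `[F₁ : ℚ] ≤ 6` (not formalised). Nothing here bears on, or takes a side on, [IUTchIII] Cor. 3.12.
-/

noncomputable section

namespace Literature.AlgebraicGeometry.Frobenioids

open CategoryTheory Opposite NumberField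

section Arith

variable {F₁ : Type} [Field F₁] [NumberField F₁] {K₁ : Type} [Field K₁] [Algebra F₁ K₁] [IsGalois F₁ K₁]
variable {F₂ : Type} [Field F₂] [NumberField F₂] {K₂ : Type} [Field K₂] [Algebra F₂ K₂] [IsGalois F₂ K₂]

/-- **What the Cor. 4.11 (iv) datum gives at the base, for arbitrary `F₁`: `F₁` and `F₂` are arithmetically
equivalent.** For an equivalence `Ψ : C_{K₁/F₁} ⥲ C_{K₂/F₂}` of THE arithmetic Frobenioids with its Cor. 4.11 (iv)
datum `(Ψ^Base, Ψ^Φ = E, η, hdiv)` and `B₁ = Spec F₁` (`ε₁ : B₁.L ≃ₐ[F₁] F₁`): `B₂ := Ψ^Base B₁` is `Spec F₂`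
(`B₂.L ≃ₐ[F₂] F₂`) and there is a bijection of finite places `π₀ : FinitePlace B₁.L ≃ FinitePlace B₂.L` preserving
residue characteristics and absolute norms (`log N(π₀ w) = log N(w)`) — Thm. 6.4 (iii) for `Ψ` itself with
`deg(Ψ^rlf) = 1` (p. 116 l. 25–27), read at the base. [cite: MochizukiFrdI2008, Thm. 6.4 (iv) p.116] -/
theorem arith_exists_base_placeEquiv (Ψ : arithFrobenioid F₁ K₁ ≌ arithFrobenioid F₂ K₂)
    {ΨBase : FinSubextCat F₁ K₁ ⥤ FinSubextCat F₂ K₂} [ΨBase.IsEquivalence]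
    (E : PreFrobenioidData.DivisorMonoidIsoOverBase (arithFrobenioidOps F₁ K₁) (arithFrobenioidOps F₂ K₂) ΨBase)
    (η : Ψ.functor ⋙ (arithFrobenioidOps F₂ K₂).base ≅ (arithFrobenioidOps F₁ K₁).base ⋙ ΨBase)
    (hdiv : ∀ ⦃A B : arithFrobenioid F₁ K₁⦄ (φ : A ⟶ B),
      (arithFrobenioidOps F₂ K₂).div (Ψ.functor.map φ) =
        (arithFrobenioidOps F₂ K₂).pull (η.hom.app A)
          (E.iso ((arithFrobenioidOps F₁ K₁).base.obj A) ((arithFrobenioidOps F₁ K₁).div φ)))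
    (B₁ : FinSubextCat F₁ K₁) (ε₁ : B₁.L ≃ₐ[F₁] F₁) :
    Nonempty ((ΨBase.obj B₁).L ≃ₐ[F₂] F₂) ∧
      ∃ π₀ : FinitePlace B₁.L ≃ FinitePlace (ΨBase.obj B₁).L,
        (∀ w, residueChar (π₀ w) = residueChar w) ∧ ∀ w, logNorm (π₀ w) = logNorm w := by
  refine ⟨FinSubextCat.nonempty_algEquiv_obj_of_algEquiv ΨBase B₁ ε₁, ?_⟩
  obtain ⟨π₀, hπ₀⟩ := EffArithDivisor.exists_finitePlaceEquiv_mulEquiv (E.iso B₁)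
  exact ⟨π₀, arith_residueChar_transport Ψ E η hdiv B₁ π₀ hπ₀, arith_logNorm_transport Ψ E η hdiv B₁ π₀ hπ₀⟩

/-- **Consequences at the base, for arbitrary `F₁`** (through abc-iut-w4-d109's T64iv/L04
`Thm64iv_L04_degreeEq_holds`, applied to `B₁.L ≅ F₁` and `B₂.L ≅ F₂`): the fields `B₁.L`, `B₂.L` have the same
number of finite places over every rational prime, the same degree over `ℚ`, and the same completely split primes —
print's «`[L₁ : ℚ] = [L₂ : ℚ]`» (p. 116 l. 35) one level down, where it does NOT by itself give an isomorphism.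
[cite: MochizukiFrdI2008, Thm. 6.4 (iv) p.116] -/
theorem arith_base_degreeEq (Ψ : arithFrobenioid F₁ K₁ ≌ arithFrobenioid F₂ K₂)
    {ΨBase : FinSubextCat F₁ K₁ ⥤ FinSubextCat F₂ K₂} [ΨBase.IsEquivalence]
    (E : PreFrobenioidData.DivisorMonoidIsoOverBase (arithFrobenioidOps F₁ K₁) (arithFrobenioidOps F₂ K₂) ΨBase)
    (η : Ψ.functor ⋙ (arithFrobenioidOps F₂ K₂).base ≅ (arithFrobenioidOps F₁ K₁).base ⋙ ΨBase)
    (hdiv : ∀ ⦃A B : arithFrobenioid F₁ K₁⦄ (φ : A ⟶ B),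
      (arithFrobenioidOps F₂ K₂).div (Ψ.functor.map φ) =
        (arithFrobenioidOps F₂ K₂).pull (η.hom.app A)
          (E.iso ((arithFrobenioidOps F₁ K₁).base.obj A) ((arithFrobenioidOps F₁ K₁).div φ)))
    (B₁ : FinSubextCat F₁ K₁) (ε₁ : B₁.L ≃ₐ[F₁] F₁) :
    (∀ p, (placesOver B₁.L p).ncard = (placesOver (ΨBase.obj B₁).L p).ncard) ∧
      Module.finrank ℚ B₁.L = Module.finrank ℚ (ΨBase.obj B₁).L ∧
        ∀ p, SplitsCompletely B₁.L p ↔ SplitsCompletely (ΨBase.obj B₁).L p := by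
  obtain ⟨-, π₀, hrc, -⟩ := arith_exists_base_placeEquiv Ψ E η hdiv B₁ ε₁
  exact Thm64iv_L04_degreeEq_holds B₁.L (ΨBase.obj B₁).L π₀ hrc

/-- **T64iv/L07b for arbitrary `F₁` from the weakest printed-faithful residual hypothesis.** Hypothesis `hsol`
(«`F₁` is arithmetically solitary along the datum»): every bijection of finite places `FinitePlace B₁.L ≃ FinitePlace B₂.L`
preserving residue characteristics and absolute norms comes with a field isomorphism `B₁.L ≅ B₂.L`. Conclusion: for
every `X = Spec L₁` with `L₁` Galois over `ℚ`, `L₂ := (Ψ^Base X).L ≅ L₁` compatibly with an isomorphism `F₁ ≅ F₂` —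
the printed clause. (The binder is an explicit hypothesis of this theorem, not a definition; it is discharged below
for `F₁` Galois over `ℚ` and follows from `F₁ ≅ F₂`.) [cite: MochizukiFrdI2008, Thm. 6.4 (iv) p.115] -/
theorem Thm64iv_arith_compat_of_solitary (Ψ : arithFrobenioid F₁ K₁ ≌ arithFrobenioid F₂ K₂)
    {ΨBase : FinSubextCat F₁ K₁ ⥤ FinSubextCat F₂ K₂} [ΨBase.IsEquivalence]
    (E : PreFrobenioidData.DivisorMonoidIsoOverBase (arithFrobenioidOps F₁ K₁) (arithFrobenioidOps F₂ K₂) ΨBase)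
    (η : Ψ.functor ⋙ (arithFrobenioidOps F₂ K₂).base ≅ (arithFrobenioidOps F₁ K₁).base ⋙ ΨBase)
    (hdiv : ∀ ⦃A B : arithFrobenioid F₁ K₁⦄ (φ : A ⟶ B),
      (arithFrobenioidOps F₂ K₂).div (Ψ.functor.map φ) =
        (arithFrobenioidOps F₂ K₂).pull (η.hom.app A)
          (E.iso ((arithFrobenioidOps F₁ K₁).base.obj A) ((arithFrobenioidOps F₁ K₁).div φ)))
    (B₁ : FinSubextCat F₁ K₁) (ε₁ : B₁.L ≃ₐ[F₁] F₁)
    (hsol : ∀ π₀ : FinitePlace B₁.L ≃ FinitePlace (ΨBase.obj B₁).L,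
      (∀ w, residueChar (π₀ w) = residueChar w) → (∀ w, logNorm (π₀ w) = logNorm w) →
        Nonempty (B₁.L ≃+* (ΨBase.obj B₁).L))
    (X : FinSubextCat F₁ K₁) (hX : IsGalois ℚ X.L) :
    ∃ (e : X.L ≃+* (ΨBase.obj X).L) (e₀ : F₁ ≃+* F₂),
      ∀ a : F₁, e (algebraMap F₁ X.L a) = algebraMap F₂ (ΨBase.obj X).L (e₀ a) := by
  obtain ⟨⟨ε₂⟩, π₀, hrc, hln⟩ := arith_exists_base_placeEquiv Ψ E η hdiv B₁ ε₁
  obtain ⟨e⟩ := hsol π₀ hrc hln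
  exact Thm64iv_arith_compat_of_baseIso Ψ E η hdiv ((ε₁.symm.toRingEquiv.trans e).trans ε₂.toRingEquiv) X hX

omit [IsGalois F₁ K₁] [IsGalois F₂ K₂] in
/-- The solitary binder HOLDS when `F₁` is Galois over `ℚ` (then so is `B₁.L ≅ F₁`, and T64iv/L07a — Bauer's
theorem with the degree count, abc-iut-w4-d109's `Thm64iv_fieldIso_of_transport` — applies at `X = B₁`).
[cite: MochizukiFrdI2008, Thm. 6.4 (iv) p.116] -/
theorem arith_solitary_of_isGalois_base [IsGalois ℚ F₁] (ΨBase : FinSubextCat F₁ K₁ ⥤ FinSubextCat F₂ K₂)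
    (B₁ : FinSubextCat F₁ K₁) (ε₁ : B₁.L ≃ₐ[F₁] F₁)
    (π₀ : FinitePlace B₁.L ≃ FinitePlace (ΨBase.obj B₁).L) (hrc : ∀ w, residueChar (π₀ w) = residueChar w)
    (hln : ∀ w, logNorm (π₀ w) = logNorm w) : Nonempty (B₁.L ≃+* (ΨBase.obj B₁).L) :=
  Thm64iv_fieldIso_of_transport ΨBase B₁ (isGalois_rat_of_algEquiv B₁ ε₁) π₀ hrc fun w => (hln w).symm

omit [IsGalois F₁ K₁] [IsGalois F₂ K₂] in
/-- The solitary binder FOLLOWS FROM an isomorphism `F₁ ≅ F₂` (so it is weaker than positing one): `B₁.L ≅ F₁ ≅ F₂ ≅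
B₂.L`. [cite: MochizukiFrdI2008, Thm. 6.4 (iv) p.115] -/
theorem arith_solitary_of_baseIso (ΨBase : FinSubextCat F₁ K₁ ⥤ FinSubextCat F₂ K₂) [ΨBase.IsEquivalence]
    (B₁ : FinSubextCat F₁ K₁) (ε₁ : B₁.L ≃ₐ[F₁] F₁) (φ : F₁ ≃+* F₂)
    (π₀ : FinitePlace B₁.L ≃ FinitePlace (ΨBase.obj B₁).L) (_hrc : ∀ w, residueChar (π₀ w) = residueChar w)
    (_hln : ∀ w, logNorm (π₀ w) = logNorm w) : Nonempty (B₁.L ≃+* (ΨBase.obj B₁).L) := by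
  obtain ⟨ε₂⟩ := FinSubextCat.nonempty_algEquiv_obj_of_algEquiv ΨBase B₁ ε₁
  exact ⟨(ε₁.toRingEquiv.trans φ).trans ε₂.toRingEquiv.symm⟩

omit [NumberField F₁] [IsGalois F₁ K₁] [NumberField F₂] [IsGalois F₂ K₂] in
/-- Conversely, the printed clause at ANY one `X` forces the conclusion of the solitary binder (`F₁ ≅ F₂`, hence
`B₁.L ≅ B₂.L`): no hypothesis of this shape weaker than `hsol` can close the row.
[cite: MochizukiFrdI2008, Thm. 6.4 (iv) p.115] -/
theorem nonempty_base_ringEquiv_of_compat (ΨBase : FinSubextCat F₁ K₁ ⥤ FinSubextCat F₂ K₂) [ΨBase.IsEquivalence]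
    (B₁ : FinSubextCat F₁ K₁) (ε₁ : B₁.L ≃ₐ[F₁] F₁) (X : FinSubextCat F₁ K₁)
    (h : ∃ (e : X.L ≃+* (ΨBase.obj X).L) (e₀ : F₁ ≃+* F₂),
      ∀ a : F₁, e (algebraMap F₁ X.L a) = algebraMap F₂ (ΨBase.obj X).L (e₀ a)) :
    Nonempty (B₁.L ≃+* (ΨBase.obj B₁).L) := by
  obtain ⟨-, e₀, -⟩ := h
  obtain ⟨ε₂⟩ := FinSubextCat.nonempty_algEquiv_obj_of_algEquiv ΨBase B₁ ε₁
  exact ⟨(ε₁.toRingEquiv.trans e₀).trans ε₂.toRingEquiv.symm⟩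

/-- **The residual of G-L1t3-1 #2 in its sharpest form at the data**: for arbitrary `F₁` and any `X` Galois over
`ℚ`, the printed clause at `X` ⟺ `Nonempty (B₁.L ≃+* B₂.L)` ⟺ `Nonempty (F₁ ≃+* F₂)`, while the datum supplies
UNCONDITIONALLY a residue-characteristic- and norm-preserving bijection `FinitePlace B₁.L ≃ FinitePlace B₂.L`
(`arith_exists_base_placeEquiv`): the open point is exactly «arithmetically equivalent ⇒ isomorphic» for the pair
`(F₁, F₂)`. [cite: MochizukiFrdI2008, Thm. 6.4 (iv) p.115] -/
theorem Thm64iv_arith_compat_iff_base_ringEquiv (Ψ : arithFrobenioid F₁ K₁ ≌ arithFrobenioid F₂ K₂)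
    {ΨBase : FinSubextCat F₁ K₁ ⥤ FinSubextCat F₂ K₂} [ΨBase.IsEquivalence]
    (E : PreFrobenioidData.DivisorMonoidIsoOverBase (arithFrobenioidOps F₁ K₁) (arithFrobenioidOps F₂ K₂) ΨBase)
    (η : Ψ.functor ⋙ (arithFrobenioidOps F₂ K₂).base ≅ (arithFrobenioidOps F₁ K₁).base ⋙ ΨBase)
    (hdiv : ∀ ⦃A B : arithFrobenioid F₁ K₁⦄ (φ : A ⟶ B),
      (arithFrobenioidOps F₂ K₂).div (Ψ.functor.map φ) =
        (arithFrobenioidOps F₂ K₂).pull (η.hom.app A)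
          (E.iso ((arithFrobenioidOps F₁ K₁).base.obj A) ((arithFrobenioidOps F₁ K₁).div φ)))
    (B₁ : FinSubextCat F₁ K₁) (ε₁ : B₁.L ≃ₐ[F₁] F₁) (X : FinSubextCat F₁ K₁) (hX : IsGalois ℚ X.L) :
    (∃ (e : X.L ≃+* (ΨBase.obj X).L) (e₀ : F₁ ≃+* F₂),
        ∀ a : F₁, e (algebraMap F₁ X.L a) = algebraMap F₂ (ΨBase.obj X).L (e₀ a)) ↔
      Nonempty (B₁.L ≃+* (ΨBase.obj B₁).L) := by
  refine ⟨nonempty_base_ringEquiv_of_compat ΨBase B₁ ε₁ X, fun ⟨e⟩ => ?_⟩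
  obtain ⟨ε₂⟩ := FinSubextCat.nonempty_algEquiv_obj_of_algEquiv ΨBase B₁ ε₁
  exact Thm64iv_arith_compat_of_baseIso Ψ E η hdiv ((ε₁.symm.toRingEquiv.trans e).trans ε₂.toRingEquiv) X hX

end Arith

end Literature.AlgebraicGeometry.Frobenioids

end
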